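import Mathlib.NumberTheory.Padics.Complex
import Mathlib.NumberTheory.Padics.RingHoms
import Mathlib.FieldTheory.IntermediateField.Adjoin.Basic
import Mathlib.FieldTheory.IsAlgClosed.Basic
import Mathlib.RingTheory.Polynomial.Basic
import Literature.NumberTheory.GaloisRepresentations.LubinTate
import Literature.IUT.LogVolume.WildDyadicCyclotomicIsometryMover
import HarnessLib

/-!
# The unramified quadratic extension `ℚ₄ = ℚ₂(ζ₃) ⊂ ℚ̄₂` in coordinates: `‖x + yζ₃‖ = max(‖x‖, ‖y‖)`, `ℚ₂(ζ₃) = ℚ₂ ⊕ ℚ₂ζ₃`,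
# `𝒪 = ℤ₂ ⊕ ℤ₂ζ₃`, and `a⁴ ≡ a (mod 2)` on `𝒪` — the concrete Lubin–Tate base `ℤ₄` for `(π, q) = (−2, 4)` (kernel)

Route `ResidualThetaTransportAtTwo` (RTT), crux (R≥)ᵖ `ResidualThetaCountLowerPureAtTwo` (stmt-BirchSwinnertonDyer-26074); seat
`prover-bsd-wall-rtt-p2` g9 (`--supports`, closes nothing); memo `Cruxes/ResidualThetaCountLowerPureAtTwo/RELATIVE-LT-g9.md` §2.
HONEST FRAMING: THEOREMS ONLY (no definition, no named fact, no instance, no `sorry`); elementary local algebra in Mathlib's `ℚ̄₂ =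
PadicAlgCl 2`, route-independent; nothing about any curve or Selmer group; BSD is not proved by any of this.

WHY. The relative Lubin–Tate keystone (`…RelativeLubinTateSeries/Module/Base/Points`, p608987 ff.) makes `Ŵ ⊗ A` a formal `A`-module
for every Lubin–Tate base `A` for `(−2, 4)`, and `isLTRing_of_isLocalRing` reduces «`A` is such a base» to `2 ∈ 𝔪_A` regular and
`a⁴ ≡ a (mod 2)`. The base every CM transport at `2` needs is `ℤ₄ = 𝒪_{ℚ₂(ζ₃)}` INSIDE `ℚ̄₂` (where TP2's towers `ℚ₂(ζ_{2^n})⁺` and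
the local points live). This file supplies the two facts about it that are not formal: the norm is computed coordinatewise in the basis
`1, ζ₃` (UNRAMIFIEDNESS: the value group stays `2^ℤ`, the residue field is `𝔽₄`), and `a⁴ ≡ a (mod 2)` for integral `a`.

WHAT (`Ω = PadicAlgCl 2`, `ζ ∈ Ω` with `ζ² + ζ + 1 = 0`; `x, y ∈ ℚ₂` coerced to `Ω`):
* `exists_zeta_three` (such `ζ` exists), `no_rat_root` (`X² + X + 1` has no root in `ℚ₂`), `natDegree_minpoly_zeta` (`= 2`);
* **`norm_add_mul_zeta : ‖x + yζ‖ = max(‖x‖, ‖y‖)`** — the tree's `Literature.IUT.LogVolume.DyadicCyclotomic.norm_combo_zeta` (with its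
  `padicTwo_norm_quad`, `zeta_cube`, `norm_zeta`; reused by name, not restated) read in coordinates of `ℚ̄₂`;
* `exists_coords_of_mem_adjoin : z ∈ ℚ₂(ζ) → ∃ x y, z = x + yζ`; **`exists_int_coords_of_mem_adjoin`**: if moreover `‖z‖ ≤ 1` then
  `‖x‖, ‖y‖ ≤ 1` (`𝒪_{ℚ₂(ζ₃)} = ℤ₂ ⊕ ℤ₂ζ₃`); `norm_mem_adjoin_le_norm_two_of_lt_one`: `‖z‖ < 1 ⇒ ‖z‖ ≤ ‖2‖` (no ramification);
* **`norm_pow_four_sub_self_le : z ∈ ℚ₂(ζ), ‖z‖ ≤ 1 ⇒ ‖z⁴ − z‖ ≤ ‖2‖`** — `a⁴ ≡ a (mod 2)`: the hypothesis `hfrob` of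
  `RelativeLubinTate.isLTRing_of_isLocalRing` for `𝒪_{ℚ₂(ζ₃)}`.

References: [SerreLocalFields1979] Ch. I §6, Ch. IV §4 (unramified extensions, Teichmüller representatives);
[CasselsFrohlichANT1967] Ch. VI §3.5 Remark 2.
-/

set_option autoImplicit false
-- the Theorems namespace of this sub repeats the summit name by design (D-0017 nested layout)
set_option linter.dupNamespace false

noncomputable section

open scoped Classical IntermediateField
open Polynomial

namespace Summit.BirchSwinnertonDyer.BirchSwinnertonDyer.Theorems.RelativeLubinTate.ZFour

/-! ## §1 `ζ₃ ∈ ℚ̄₂` -/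

/-- A primitive cube root of unity exists in `ℚ̄₂`. [folklore] -/
theorem exists_zeta_three : ∃ ζ : PadicAlgCl 2, ζ ^ 2 + ζ + 1 = 0 := by
  have hnd : (X ^ 2 + X + 1 : (PadicAlgCl 2)[X]).natDegree = 2 := by compute_degree!
  have hdeg : (X ^ 2 + X + 1 : (PadicAlgCl 2)[X]).degree ≠ 0 :=
    (natDegree_pos_iff_degree_pos.mp (by omega)).ne'
  obtain ⟨ζ, hζ⟩ := IsAlgClosed.exists_root (X ^ 2 + X + 1 : (PadicAlgCl 2)[X]) hdeg
  refine ⟨ζ, ?_⟩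
  simpa [IsRoot, eval_add, eval_pow, eval_X, eval_one] using hζ

variable {ζ : PadicAlgCl 2} (hζ : ζ ^ 2 + ζ + 1 = 0)

/-- `X² + X + 1` has no root in `ℚ₂`: a root would be a `2`-adic unit, and `x² + x + 1` has no root in `𝔽₂`. [folklore] -/
theorem no_rat_root (r : ℚ_[2]) : r ^ 2 + r + 1 ≠ 0 := by
  intro hr
  -- `‖r‖ ≤ 1`: otherwise `‖r²‖ > ‖r + 1‖`
  have hr1 : ‖r‖ ≤ 1 := by
    by_contra h
    push Not at h
    have hsq : r ^ 2 = -(r + 1) := by linear_combination hr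
    have h1 : ‖r + 1‖ ≤ ‖r‖ := by
      refine (IsUltrametricDist.norm_add_le_max r 1).trans ?_
      rw [norm_one]
      exact max_le le_rfl h.le
    have h2 : ‖r ^ 2‖ = ‖r‖ * ‖r‖ := by rw [norm_pow, sq]
    rw [hsq, norm_neg] at h2
    have : ‖r‖ * ‖r‖ ≤ ‖r‖ * 1 := by rw [mul_one, ← h2]; exact h1
    have hpos : 0 < ‖r‖ := lt_trans zero_lt_one h
    exact absurd (le_of_mul_le_mul_left this hpos) (not_le.mpr h)
  set z : ℤ_[2] := ⟨r, hr1⟩ with hz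
  have hz2 : z ^ 2 + z + 1 = 0 := by
    apply Subtype.ext
    change r ^ 2 + r + 1 = 0
    exact hr
  have h := congrArg PadicInt.toZMod hz2
  rw [map_add, map_add, map_pow, map_one, map_zero] at h
  revert h
  generalize PadicInt.toZMod z = a
  decide +revert

/-! ## §2 `‖x + yζ‖ = max(‖x‖, ‖y‖)` (the tree's unit-layer norm formula, in coordinates) -/

include hζ in
/-- **Unramifiedness of `ℚ₂(ζ₃)/ℚ₂` in coordinates: `‖x + yζ‖ = max(‖x‖, ‖y‖)`** for `x, y ∈ ℚ₂` — `1, ζ` is an ORTHOGONAL basis, the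
value group of `ℚ₂(ζ₃)` is `2^ℤ` and `𝒪_{ℚ₂(ζ₃)} = ℤ₂ ⊕ ℤ₂ζ₃`. This is the tree's `DyadicCyclotomic.norm_combo_zeta` (IUT log-volume series:
`‖a•1 + b•ζ‖ = max ‖a‖ ‖b‖` in any ultrametric normed `ℚ₂`-algebra, from the norm form `a² − ab + b²`) read in `ℚ̄₂`.
[cite: SerreLocalFields1979, Ch. I §6] -/
theorem norm_add_mul_zeta (x y : ℚ_[2]) : ‖(x : PadicAlgCl 2) + y * ζ‖ = max ‖x‖ ‖y‖ := by
  have h := Literature.IUT.LogVolume.DyadicCyclotomic.norm_combo_zeta (K := PadicAlgCl 2) hζ x y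
  rw [Algebra.smul_def, mul_one, Algebra.smul_def] at h
  exact h

/-! ## §3 `ℚ₂(ζ₃) = ℚ₂ ⊕ ℚ₂ζ₃`, `𝒪_{ℚ₂(ζ₃)} = ℤ₂ ⊕ ℤ₂ζ₃`, no ramification, and `a⁴ ≡ a (mod 2)` -/

include hζ in
/-- `ζ` is integral over `ℚ₂` (root of the monic `X² + X + 1`). [folklore] -/
theorem isIntegral_zeta : IsIntegral ℚ_[2] ζ := by
  refine ⟨X ^ 2 + X + 1, by monicity!, ?_⟩
  simpa [eval₂_add, eval₂_pow, eval₂_X, eval₂_one] using hζ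

include hζ in
/-- `[ℚ₂(ζ₃) : ℚ₂] = 2`: the minimal polynomial of `ζ` has degree `2` (it divides `X² + X + 1`, and `ζ ∉ ℚ₂`). [folklore] -/
theorem natDegree_minpoly_zeta : (minpoly ℚ_[2] ζ).natDegree = 2 := by
  have hint := isIntegral_zeta hζ
  have hle : (minpoly ℚ_[2] ζ).natDegree ≤ 2 := by
    have hnd : (X ^ 2 + X + 1 : ℚ_[2][X]).natDegree = 2 := by compute_degree!
    have hmon : (X ^ 2 + X + 1 : ℚ_[2][X]).Monic := by monicity!
    have hroot : aeval ζ (X ^ 2 + X + 1 : ℚ_[2][X]) = 0 := by simpa [aeval_def, eval₂_add, eval₂_pow, eval₂_X] using hζ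
    have h := minpoly.min ℚ_[2] ζ hmon hroot
    rw [degree_eq_natDegree (minpoly.ne_zero hint), degree_eq_natDegree hmon.ne_zero, hnd] at h
    exact_mod_cast h
  have hpos : 0 < (minpoly ℚ_[2] ζ).natDegree := minpoly.natDegree_pos hint
  have hne1 : (minpoly ℚ_[2] ζ).natDegree ≠ 1 := by
    intro h1
    rw [minpoly.natDegree_eq_one_iff] at h1
    obtain ⟨r, hr⟩ := h1
    apply no_rat_root r
    have : (algebraMap ℚ_[2] (PadicAlgCl 2)) (r ^ 2 + r + 1) = 0 := by
      rw [map_add, map_add, map_pow, map_one, hr, hζ]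
    exact (map_eq_zero_iff _ (algebraMap ℚ_[2] (PadicAlgCl 2)).injective).mp this
  omega

include hζ in
/-- **`ℚ₂(ζ₃) = ℚ₂ ⊕ ℚ₂ζ₃`**: every element of `ℚ₂(ζ)` is `x + yζ` with `x, y ∈ ℚ₂`. [folklore] -/
theorem exists_coords_of_mem_adjoin {z : PadicAlgCl 2} (hz : z ∈ ℚ_[2]⟮ζ⟯) :
    ∃ x y : ℚ_[2], z = (x : PadicAlgCl 2) + y * ζ := by
  have halg : IsAlgebraic ℚ_[2] ζ := (isIntegral_zeta hζ).isAlgebraic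
  have hz' : z ∈ (ℚ_[2]⟮ζ⟯).toSubalgebra := hz
  rw [IntermediateField.adjoin_simple_toSubalgebra_of_isAlgebraic halg, Algebra.adjoin_singleton_eq_range_aeval] at hz'
  obtain ⟨q, rfl⟩ := hz'
  have hmonic : (minpoly ℚ_[2] ζ).Monic := minpoly.monic (isIntegral_zeta hζ)
  have h1 : minpoly ℚ_[2] ζ ≠ 1 := by
    intro h
    have := congrArg natDegree h
    rw [natDegree_minpoly_zeta hζ, natDegree_one] at this
    exact absurd this (by decide)
  have hrdeg : (q %ₘ minpoly ℚ_[2] ζ).natDegree ≤ 1 := by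
    have := natDegree_modByMonic_lt q hmonic h1
    rw [natDegree_minpoly_zeta hζ] at this
    omega
  have hqr : aeval ζ q = aeval ζ (q %ₘ minpoly ℚ_[2] ζ) :=
    (aeval_modByMonic_eq_self_of_root (minpoly.aeval ℚ_[2] ζ)).symm
  have hr' := eq_X_add_C_of_natDegree_le_one hrdeg
  refine ⟨(q %ₘ minpoly ℚ_[2] ζ).coeff 0, (q %ₘ minpoly ℚ_[2] ζ).coeff 1, ?_⟩
  change (aeval ζ q : PadicAlgCl 2) = _
  rw [hqr, hr']
  simp only [map_add, map_mul, aeval_C, aeval_X, coeff_add, coeff_C_mul, coeff_X_zero, coeff_X_one, coeff_C_zero,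
    coeff_C_succ, mul_zero, mul_one, zero_add, add_zero]
  ring

include hζ in
/-- **`𝒪_{ℚ₂(ζ₃)} = ℤ₂ ⊕ ℤ₂ζ₃`**: an element of `ℚ₂(ζ)` of norm `≤ 1` has coordinates of norm `≤ 1`. [cite: SerreLocalFields1979, Ch. I §6] -/
theorem exists_int_coords_of_mem_adjoin {z : PadicAlgCl 2} (hz : z ∈ ℚ_[2]⟮ζ⟯) (hz1 : ‖z‖ ≤ 1) :
    ∃ x y : ℚ_[2], ‖x‖ ≤ 1 ∧ ‖y‖ ≤ 1 ∧ z = (x : PadicAlgCl 2) + y * ζ := by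
  obtain ⟨x, y, rfl⟩ := exists_coords_of_mem_adjoin hζ hz
  rw [norm_add_mul_zeta hζ] at hz1
  exact ⟨x, y, le_trans (le_max_left _ _) hz1, le_trans (le_max_right _ _) hz1, rfl⟩

/-- In `ℚ₂`, `‖x‖ < 1` forces `‖x‖ ≤ ‖2‖` (value group `2^ℤ`). [folklore] -/
theorem padic_norm_le_norm_two_of_lt_one {x : ℚ_[2]} (hx : ‖x‖ < 1) : ‖x‖ ≤ ‖(2 : ℚ_[2])‖ := by
  set k : ℤ_[2] := ⟨x, hx.le⟩ with hk
  have hk1 : ‖k‖ < 1 := hx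
  obtain ⟨m, hm⟩ := (PadicInt.norm_lt_one_iff_dvd k).mp hk1
  have hxk : x = (k : ℚ_[2]) := rfl
  have : x = (2 : ℚ_[2]) * (m : ℚ_[2]) := by
    rw [hxk, hm]
    push_cast
    rfl
  rw [this, norm_mul]
  exact mul_le_of_le_one_right (norm_nonneg _) (PadicInt.norm_le_one m)

include hζ in
/-- **No ramification**: on `ℚ₂(ζ₃)`, `‖z‖ < 1 ⇒ ‖z‖ ≤ ‖2‖` — `2` is a uniformiser of `ℚ₂(ζ₃)` (the value group is that of `ℚ₂`), so its
valuation ring has maximal ideal `(2)` and residue field `𝔽₄`. [cite: SerreLocalFields1979, Ch. I §6] -/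
theorem norm_mem_adjoin_le_norm_two_of_lt_one {z : PadicAlgCl 2} (hz : z ∈ ℚ_[2]⟮ζ⟯) (hz1 : ‖z‖ < 1) :
    ‖z‖ ≤ ‖(2 : PadicAlgCl 2)‖ := by
  obtain ⟨x, y, rfl⟩ := exists_coords_of_mem_adjoin hζ hz
  rw [norm_add_mul_zeta hζ] at hz1 ⊢
  have h2 : ‖(2 : PadicAlgCl 2)‖ = ‖(2 : ℚ_[2])‖ := by
    rw [← map_ofNat (algebraMap ℚ_[2] (PadicAlgCl 2)) 2, PadicAlgCl.norm_extends]
  rw [h2]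
  exact max_le (padic_norm_le_norm_two_of_lt_one (lt_of_le_of_lt (le_max_left _ _) hz1))
    (padic_norm_le_norm_two_of_lt_one (lt_of_le_of_lt (le_max_right _ _) hz1))

/-- A `2`-adic integer with zero reduction has norm `≤ ‖2‖`. [folklore] -/
theorem padicInt_norm_le_norm_two_of_toZMod_eq_zero {k : ℤ_[2]} (hk : PadicInt.toZMod k = 0) :
    ‖(k : ℚ_[2])‖ ≤ ‖(2 : ℚ_[2])‖ := by
  have hk1 : ‖k‖ < 1 := by
    rw [← PadicInt.mem_nonunits, ← IsLocalRing.mem_maximalIdeal (R := ℤ_[2]), ← PadicInt.ker_toZMod, RingHom.mem_ker]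
    exact hk
  exact padic_norm_le_norm_two_of_lt_one hk1

include hζ in
/-- **`a⁴ ≡ a (mod 2)` on `𝒪_{ℚ₂(ζ₃)}`**: for `z ∈ ℚ₂(ζ)` with `‖z‖ ≤ 1`, `‖z⁴ − z‖ ≤ ‖2‖`. With `z = x + yζ` (`x, y ∈ ℤ₂`):
`z⁴ − z = (x⁴ − 6x²y² + 4xy³ − x) + (4x³y − 6x²y² + y⁴ − y)ζ`, both coordinates `≡ x⁴ − x ≡ 0`, `y⁴ − y ≡ 0 (mod 2)`. This is the
hypothesis `hfrob` of `RelativeLubinTate.isLTRing_of_isLocalRing` for `ℤ₄ = 𝒪_{ℚ₂(ζ₃)}` (residue field `𝔽₄`).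
[cite: SerreLocalFields1979, Ch. IV §4] -/
theorem norm_pow_four_sub_self_le {z : PadicAlgCl 2} (hz : z ∈ ℚ_[2]⟮ζ⟯) (hz1 : ‖z‖ ≤ 1) :
    ‖z ^ 4 - z‖ ≤ ‖(2 : PadicAlgCl 2)‖ := by
  obtain ⟨x, y, hx, hy, rfl⟩ := exists_int_coords_of_mem_adjoin hζ hz hz1
  set A : ℚ_[2] := x ^ 4 - 6 * x ^ 2 * y ^ 2 + 4 * x * y ^ 3 - x with hA
  set B : ℚ_[2] := 4 * x ^ 3 * y - 6 * x ^ 2 * y ^ 2 + y ^ 4 - y with hB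
  have he : ((x : PadicAlgCl 2) + y * ζ) ^ 4 - ((x : PadicAlgCl 2) + y * ζ) = (A : PadicAlgCl 2) + B * ζ := by
    rw [hA, hB]
    simp only [map_sub, map_add, map_mul, map_pow, map_ofNat]
    linear_combination (6 * (x : PadicAlgCl 2) ^ 2 * (y : PadicAlgCl 2) ^ 2 + 4 * (x : PadicAlgCl 2) * (y : PadicAlgCl 2) ^ 3 * (ζ - 1)
      + (y : PadicAlgCl 2) ^ 4 * ζ * (ζ - 1)) * hζ
  rw [he, norm_add_mul_zeta hζ]
  have h2 : ‖(2 : PadicAlgCl 2)‖ = ‖(2 : ℚ_[2])‖ := by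
    rw [← map_ofNat (algebraMap ℚ_[2] (PadicAlgCl 2)) 2, PadicAlgCl.norm_extends]
  rw [h2]
  -- integral coordinates
  set xi : ℤ_[2] := ⟨x, hx⟩ with hxi
  set yi : ℤ_[2] := ⟨y, hy⟩ with hyi
  have hAi : A = ((xi ^ 4 - 6 * xi ^ 2 * yi ^ 2 + 4 * xi * yi ^ 3 - xi : ℤ_[2]) : ℚ_[2]) := by
    rw [hA]; push_cast; rfl
  have hBi : B = ((4 * xi ^ 3 * yi - 6 * xi ^ 2 * yi ^ 2 + yi ^ 4 - yi : ℤ_[2]) : ℚ_[2]) := by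
    rw [hB]; push_cast; rfl
  have hmodA : PadicInt.toZMod (xi ^ 4 - 6 * xi ^ 2 * yi ^ 2 + 4 * xi * yi ^ 3 - xi) = 0 := by
    simp only [map_sub, map_add, map_mul, map_pow, map_ofNat]
    generalize PadicInt.toZMod xi = a
    generalize PadicInt.toZMod yi = b
    revert a b
    decide
  have hmodB : PadicInt.toZMod (4 * xi ^ 3 * yi - 6 * xi ^ 2 * yi ^ 2 + yi ^ 4 - yi) = 0 := by
    simp only [map_sub, map_add, map_mul, map_pow, map_ofNat]
    generalize PadicInt.toZMod xi = a
    generalize PadicInt.toZMod yi = b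
    revert a b
    decide
  rw [hAi, hBi]
  exact max_le (padicInt_norm_le_norm_two_of_toZMod_eq_zero hmodA) (padicInt_norm_le_norm_two_of_toZMod_eq_zero hmodB)

end Summit.BirchSwinnertonDyer.BirchSwinnertonDyer.Theorems.RelativeLubinTate.ZFour

end
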